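import Literature.NumberTheory.EllipticCurves.NewformsMainLemma
import Literature.NumberTheory.EllipticCurves.NewformsOldNewProofs
import Literature.NumberTheory.EllipticCurves.NewformsLevelRaising
import Literature.NumberTheory.EllipticCurves.NewformsProofs
import Literature.NumberTheory.EllipticCurves.NewformsHeckeProofs
import Literature.NumberTheory.EllipticCurves.HeckeOperatorsGamma0Proofs
import Literature.NumberTheory.EllipticCurves.HeckeOperatorsDiamondProofs
import Literature.NumberTheory.EllipticCurves.HeckeOperatorsDiamondCommProofs
import Literature.NumberTheory.EllipticCurves.HeckeOperatorsDoubleCoset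
import Literature.NumberTheory.EllipticCurves.NewformsFrickeSignProofs
import HarnessLib

/-!
# The Main Lemma on `Γ₀(N)` (Atkin–Lehner 1970, Thm. 1) from the Main Lemma on `Γ₁(N)`
# (Diamond–Shurman Thm. 5.7.1), and its consequences (`NewformsMainLemma`, proofs)

D-0014 keeps `Literature/` sorry-free by stating cited results as named facts `def X : Prop`.
This sibling of `Literature.NumberTheory.EllipticCurves.NewformsMainLemma` **derives the `Γ₀(N)`
Main Lemma** — the named fact `atkinLehnerMainLemma0 N k` of `NewformsLevelRaising` (Atkin–Lehner
1970, Thm. 1: `f ∈ S_k(Γ₀(N))` with `a_n(f) = 0` for `(n, N) = 1` is `∑_p ι_p f_p`,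
`f_p ∈ S_k(Γ₀(N/p))`) — **from the `Γ₁(N)` Main Lemma `atkinLehnerMainLemma1 N k`**
(Diamond–Shurman Thm. 5.7.1, the printed, held statement), by averaging over the diamond
operators; and records the consequences for newforms on `Γ₀(N)` conditional on Diamond–Shurman
Thm. 5.7.1 alone:

* `atkinLehnerMainLemma0_of_mainLemma1 : atkinLehnerMainLemma1 N k → atkinLehnerMainLemma0 N k`,
  `mem_oldSubspace0_of_coeff_eq_zero` (membership in `oldSubspace0 N k`), through the core
  statement `exists_eq_sum_smul_degeneracyMap0_of_coeff_eq_zero`;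
* `IsNewform0.exists_frickeInvolution_eq_smul_of_mainLemma1`, `IsNewform0.frickeFacts_of_mainLemma1`
  — Atkin–Lehner 1970, Thm. 3 (`w_N f = ± f` for newforms) and Hecke's functional equation for
  newforms `IsNewform0.exists_functional_equation`, from `atkinLehnerMainLemma1 N k`
  (`NewformsFrickeSignProofs` proves them from `atkinLehnerMainLemma0 N k`);
* `IsNewform0.eq_of_heckeEigenvalue_eq_of_mainLemma1` — strong multiplicity one at level `N`
  (Atkin–Lehner 1970, Thm. 4), from `atkinLehnerMainLemma1 N k`
  (`IsNewform0.eq_of_heckeEigenvalue_eq_of_facts` of `NewformsLevelRaising` proves it from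
  `atkinLehnerMainLemma0` and `disjoint_oldSubspace0_newSubspace0`, the latter discharged in
  `NewformsOldNewProofs`; cf. `IsNewform0.eq_of_heckeEigenvalue_eq_of_mainLemma` of
  `NewformsLevelLowering`, conditional on `atkinLehnerMainLemma0`).

On the way (all proved, of independent use):

* `coe_degeneracyMap0_eq_slash`, `coe_degeneracyMap1_eq_slash`: for `M d ∣ N` the degeneracy maps
  `degeneracyMap0/1 M N d k = [Γ(M) α_d Γ(N)]` of `Newforms` are the single slash `g ↦ g ∣[k] α_d`,
  `α_d = diag(d, 1)` — the double coset `Γ(M) α_d Γ(N)` is the one right coset `Γ(M) α_d`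
  (`isDoubleCosetDecomp_diagGL_gamma0/1`) because `α_d Γ(N) α_d⁻¹ ⊆ Γ(M)`
  (`exists_mul_diag_eq_diag_mul`: `α_d (a b; c δ) α_d⁻¹ = (a, db; c/d, δ)`); Diamond–Shurman §5.6,
  p. 209 (`[α_d]_k` takes level `M` to level `N`, Exercise 1.2.11);
* `coe_diamondOp_gamma0Map`: `⟨d⟩ F = F ∣[k] γ` for *any* `γ ∈ Γ₀(N)` with lower-right entry `≡ d`;
  `diamondOp_degeneracyMap1`: `⟨d⟩_N ∘ ι = ι ∘ ⟨d mod M⟩_M` (Diamond–Shurman Prop. 5.6.2, first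
  diagram); `exists_liftToGamma1_eq_of_forall_diamondOp_eq`: a form of level `Γ₁(M)` fixed by all
  `⟨d⟩` comes from `Γ₀(M)` (Diamond–Shurman §4.3 p. 119, §5.2 p. 168: `S_k(Γ₀(M)) = S_k(M, 𝟙)`);
  `degeneracyMap1_liftToGamma1`, `liftToGamma1_injective`.

## The printed proof and this file

Diamond–Shurman prove the Main Lemma for `Γ₁(N)` (Thm. 5.7.1, PDF p. 211; Carlton's proof) and
attribute the `Γ₀(N)` statement to Atkin–Lehner (p. 212). The passage `Γ₁(N) ⇒ Γ₀(N)` formalised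
here is the standard averaging argument: for `f ∈ S_k(Γ₀(N)) = S_k(N, 𝟙) ⊆ S_k(Γ₁(N))` with
vanishing prime-to-`N` coefficients, Thm. 5.7.1 gives `f = ∑_{p ∣ N} p^{1-k} ι_p g_p` with
`g_p ∈ S_k(Γ₁(N/p))`, `ι_p = [α_p]_k = degeneracyMap1 (N/p) N p k`. Apply `∑_{d ∈ (ℤ/Nℤ)ˣ} ⟨d⟩`:
on `f` this is multiplication by `φ(N)` (`diamondOp_liftToGamma1`), and `⟨d⟩ ι_p = ι_p ⟨d mod N/p⟩`,
so `φ(N) f = ∑_p p^{1-k} ι_p G_p` with `G_p = ∑_d ⟨d mod N/p⟩ g_p` fixed by every diamond operator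
of level `N/p` (units mod `N/p` lift to units mod `N`, `ZMod.unitsMap_surjective`), hence
`G_p ∈ S_k(Γ₀(N/p))` and `ι_p G_p = degeneracyMap0 (N/p) N p k G_p = p^{k-1} ι_p G_p ∈ range ι_p`
(`range_iota_eq_range_degeneracyMap0` of `NewformsLevelRaising`).

## References

* F. Diamond, J. Shurman, *A first course in modular forms*, GTM 228, Springer 2005, §4.3 (p. 119),
  §5.2 (p. 168), §5.6 (Def. 5.6.1, Prop. 5.6.2; PDF p. 209), §5.7 (Thm. 5.7.1; PDF pp. 211–212).
  doi:10.1007/978-0-387-27226-9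
* A. O. L. Atkin, J. Lehner, *Hecke operators on `Γ₀(m)`*, Math. Ann. 185 (1970), 134–160,
  Thms. 1, 3, 4.
-/

noncomputable section

open scoped MatrixGroups ModularForm

open CongruenceSubgroup UpperHalfPlane Matrix.SpecialLinearGroup

namespace Literature.NumberTheory.EllipticCurves.ModularForms

/-! ### Degeneracy maps are single slashes: `Γ(M) α_d Γ(N) = Γ(M) α_d` for `M d ∣ N` -/

section DegeneracySlash

variable {M N : ℕ} {d : ℕ}

/-- `det diag(d, 1) = d ≠ 0` for the integer matrix `α_d = diag(d, 1)`, `d ≥ 1`. [folklore] -/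
lemma det_diag_ne_zero (hd : d ≠ 0) : (!![(d : ℤ), 0; 0, 1] : Matrix (Fin 2) (Fin 2) ℤ).det ≠ 0 := by
  rw [Matrix.det_fin_two_of]
  simpa using hd

/-- `glCast α_d = intGL diag(d, 1)`. [folklore] -/
lemma glCast_diagGL_eq_intGL (hd : 0 < d) :
    glCast (diagGL (d : ℚ) 1 (Nat.cast_pos.mpr hd) one_pos : GL (Fin 2) ℚ) =
      intGL !![(d : ℤ), 0; 0, 1] := by
  ext i j
  rw [intGL_apply (det_diag_ne_zero hd.ne')]
  fin_cases i <;> fin_cases j <;> simp [glCast, diagGL]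

/-- **`α_d` conjugates `Γ₀(N)` into `Γ₀(M)` when `M d ∣ N`**: for `γ = (a b; c δ) ∈ Γ₀(N)`,
`α_d γ α_d⁻¹ = (a, d b; c/d, δ) =: γ' ∈ Γ₀(M)`, stated without inverses as `γ' α_d = α_d γ`; moreover
`γ'` has the same diagonal entries as `γ`, and `γ ∈ Γ₁(N) ⇒ γ' ∈ Γ₁(M)`
(Diamond–Shurman §5.6, p. 209, proof that `[α_d]_k` maps level `M` to level `N`, Exercise 1.2.11). [folklore] -/
lemma exists_mul_diag_eq_diag_mul (hMd : M * d ∣ N) {γ : SL(2, ℤ)} (hγ : γ ∈ Gamma0 N) :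
    ∃ γ' : SL(2, ℤ), γ' ∈ Gamma0 M ∧
      (γ' : Matrix (Fin 2) (Fin 2) ℤ) * !![(d : ℤ), 0; 0, 1] = !![(d : ℤ), 0; 0, 1] * γ ∧
      γ' 1 1 = γ 1 1 ∧ (γ ∈ Gamma1 N → γ' ∈ Gamma1 M) := by
  have hc : ((N : ℤ) : ℤ) ∣ γ 1 0 := by
    have h := Gamma0_mem.mp hγ
    exact (ZMod.intCast_zmod_eq_zero_iff_dvd _ N).mp h
  obtain ⟨c₂, hc₂⟩ : ((M : ℤ) * d) ∣ γ 1 0 := by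
    refine dvd_trans ?_ hc
    exact_mod_cast Int.natCast_dvd_natCast.mpr hMd
  have hdet := Matrix.SpecialLinearGroup.det_coe γ
  rw [Matrix.det_fin_two, hc₂] at hdet
  refine ⟨⟨!![γ 0 0, (d : ℤ) * γ 0 1; (M : ℤ) * c₂, γ 1 1], ?_⟩, ?_, ?_, rfl, ?_⟩
  · rw [Matrix.det_fin_two_of]
    linear_combination hdet
  · rw [Gamma0_mem]
    show ((((M : ℤ) * c₂ : ℤ)) : ZMod M) = 0
    push_cast
    simp
  · show !![γ 0 0, (d : ℤ) * γ 0 1; (M : ℤ) * c₂, γ 1 1] * !![(d : ℤ), 0; 0, 1] =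
      !![(d : ℤ), 0; 0, 1] * γ
    ext i j
    fin_cases i <;> fin_cases j <;>
      simp [Matrix.mul_apply, Fin.sum_univ_two, hc₂] <;> ring
  · intro h1
    have hMN : M ∣ N := (dvd_mul_right M d).trans hMd
    rw [Gamma1_mem] at h1 ⊢
    obtain ⟨h00, h11, -⟩ := h1
    have h00' : ((γ 0 0 : ℤ) : ZMod M) = 1 := by
      have := congrArg (ZMod.castHom hMN (ZMod M)) h00
      rwa [map_intCast, map_one] at this
    have h11' : ((γ 1 1 : ℤ) : ZMod M) = 1 := by
      have := congrArg (ZMod.castHom hMN (ZMod M)) h11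
      rwa [map_intCast, map_one] at this
    refine ⟨h00', h11', ?_⟩
    show ((((M : ℤ) * c₂ : ℤ)) : ZMod M) = 0
    push_cast
    simp

/-- The key `GL(2, ℝ)` identity `α_d γ α_d⁻¹ = γ'` from `exists_mul_diag_eq_diag_mul`. [folklore] -/
lemma exists_diagGL_mul_mapGL_mul_inv_eq (hd : 0 < d) (hMd : M * d ∣ N) {γ : SL(2, ℤ)}
    (hγ : γ ∈ Gamma0 N) :
    ∃ γ' : SL(2, ℤ), γ' ∈ Gamma0 M ∧ γ' 1 1 = γ 1 1 ∧ (γ ∈ Gamma1 N → γ' ∈ Gamma1 M) ∧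
      glCast (diagGL (d : ℚ) 1 (Nat.cast_pos.mpr hd) one_pos : GL (Fin 2) ℚ) *
          (mapGL ℝ γ : GL (Fin 2) ℝ) *
        (glCast (diagGL (d : ℚ) 1 (Nat.cast_pos.mpr hd) one_pos : GL (Fin 2) ℚ))⁻¹ =
        mapGL ℝ γ' := by
  obtain ⟨γ', hγ', h, h11, h1⟩ := exists_mul_diag_eq_diag_mul hMd hγ
  refine ⟨γ', hγ', h11, h1, ?_⟩
  have hD := det_diag_ne_zero (d := d) hd.ne'
  have hγd : ((γ : SL(2, ℤ)) : Matrix (Fin 2) (Fin 2) ℤ).det ≠ 0 := by simp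
  have hγ'd : ((γ' : SL(2, ℤ)) : Matrix (Fin 2) (Fin 2) ℤ).det ≠ 0 := by simp
  rw [mul_inv_eq_iff_eq_mul, mapGL_eq_intGL, mapGL_eq_intGL, glCast_diagGL_eq_intGL hd,
    ← intGL_mul hD hγd, ← intGL_mul hγ'd hD, h]

/-- `α_d ∈ Γ α_d Γ'` (trivially). [folklore] -/
lemma diagGL_mem_doubleCoset (hd : 0 < d) (Γ Γ' : Subgroup (GL (Fin 2) ℝ)) :
    glCast (diagGL (d : ℚ) 1 (Nat.cast_pos.mpr hd) one_pos : GL (Fin 2) ℚ) ∈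
      DoubleCoset.doubleCoset (glCast (diagGL (d : ℚ) 1 (Nat.cast_pos.mpr hd) one_pos :
        GL (Fin 2) ℚ)) (Γ : Set (GL (Fin 2) ℝ)) Γ' :=
  DoubleCoset.mem_doubleCoset.mpr ⟨1, one_mem _, 1, one_mem _, by simp⟩

/-- **`Γ₀(M) α_d Γ₀(N) = Γ₀(M) α_d` for `M d ∣ N`**: the double coset is a single right coset
(a right coset decomposition indexed by `Unit`), because `α_d Γ₀(N) α_d⁻¹ ⊆ Γ₀(M)`
(Diamond–Shurman §5.6, p. 209 / Exercise 1.2.11: `[α_d]_k` takes level `M` to level `N`). [cite: DiamondShurman2005, §5.6 p. 209] -/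
theorem isDoubleCosetDecomp_diagGL_gamma0 (hd : 0 < d) (hMd : M * d ∣ N) :
    IsDoubleCosetDecomp (Gamma0 M : Subgroup (GL (Fin 2) ℝ)) (Gamma0 N : Subgroup (GL (Fin 2) ℝ))
      (glCast (diagGL (d : ℚ) 1 (Nat.cast_pos.mpr hd) one_pos : GL (Fin 2) ℚ))
      (fun _ : Unit ↦ glCast (diagGL (d : ℚ) 1 (Nat.cast_pos.mpr hd) one_pos : GL (Fin 2) ℚ)) := by
  refine ⟨fun _ ↦ diagGL_mem_doubleCoset hd _ _, fun x hx ↦ ⟨(), ?_, fun _ _ ↦ rfl⟩⟩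
  obtain ⟨a, ha, b, hb, rfl⟩ := DoubleCoset.mem_doubleCoset.mp hx
  obtain ⟨γ, hγ, rfl⟩ := Subgroup.mem_map.mp hb
  obtain ⟨γ', hγ', -, -, key⟩ := exists_diagGL_mul_mapGL_mul_inv_eq hd hMd hγ
  rw [mul_assoc a, mul_assoc a, key]
  exact mul_mem ha (Subgroup.mem_map_of_mem _ hγ')

/-- **`Γ₁(M) α_d Γ₁(N) = Γ₁(M) α_d` for `M d ∣ N`** (single right coset), because
`α_d Γ₁(N) α_d⁻¹ ⊆ Γ₁(M)` (Diamond–Shurman §5.6, p. 209 / Exercise 1.2.11). [cite: DiamondShurman2005, §5.6 p. 209] -/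
theorem isDoubleCosetDecomp_diagGL_gamma1 (hd : 0 < d) (hMd : M * d ∣ N) :
    IsDoubleCosetDecomp (Gamma1 M : Subgroup (GL (Fin 2) ℝ)) (Gamma1 N : Subgroup (GL (Fin 2) ℝ))
      (glCast (diagGL (d : ℚ) 1 (Nat.cast_pos.mpr hd) one_pos : GL (Fin 2) ℚ))
      (fun _ : Unit ↦ glCast (diagGL (d : ℚ) 1 (Nat.cast_pos.mpr hd) one_pos : GL (Fin 2) ℚ)) := by
  refine ⟨fun _ ↦ diagGL_mem_doubleCoset hd _ _, fun x hx ↦ ⟨(), ?_, fun _ _ ↦ rfl⟩⟩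
  obtain ⟨a, ha, b, hb, rfl⟩ := DoubleCoset.mem_doubleCoset.mp hx
  obtain ⟨γ, hγ, rfl⟩ := Subgroup.mem_map.mp hb
  obtain ⟨γ', -, -, h1, key⟩ :=
    exists_diagGL_mul_mapGL_mul_inv_eq hd hMd (Gamma1_in_Gamma0 N hγ)
  rw [mul_assoc a, mul_assoc a, key]
  exact mul_mem ha (Subgroup.mem_map_of_mem _ (h1 hγ))

variable (M N d) (k : ℤ)

/-- **The degeneracy map is the single slash `g ↦ g ∣[k] α_d`** when `M d ∣ N`:
`degeneracyMap0 M N d k g = g[α_d]_k` as functions on `ℍ`, i.e. `d^{k-1} g(dτ)`, Diamond–Shurman's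
`i_d`/`ι_d` up to the scalar (§5.6 p. 209, §5.7 p. 211); by the double coset formula for the
one-coset decomposition `isDoubleCosetDecomp_diagGL_gamma0`. [cite: DiamondShurman2005, §5.6 p. 209] -/
theorem coe_degeneracyMap0_eq_slash [NeZero M] [NeZero N] [NeZero d] (hMd : M * d ∣ N)
    (g : CuspForm (Gamma0 M) k) :
    (⇑(degeneracyMap0 M N d k g) : ℍ → ℂ) =
      ⇑g ∣[k] glCast (diagGL (d : ℚ) 1 (Nat.cast_pos.mpr (NeZero.pos d)) one_pos : GL (Fin 2) ℚ) := by
  change ⇑(cuspHeckeCorrespondence _ _ k _ g) = _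
  rw [coe_cuspHeckeCorrespondence_eq_sum _ _ k _ (isDoubleCosetDecomp_diagGL_gamma0 (NeZero.pos d) hMd)]
  simp

/-- **The degeneracy map on `Γ₁` is the single slash `g ↦ g ∣[k] α_d`** when `M d ∣ N`
(Diamond–Shurman §5.6 p. 209, §5.7 p. 211: `ι_d = d^{1-k}[α_d]_k`). [cite: DiamondShurman2005, §5.6 p. 209] -/
theorem coe_degeneracyMap1_eq_slash [NeZero M] [NeZero N] [NeZero d] (hMd : M * d ∣ N)
    (g : CuspForm (Gamma1 M) k) :
    (⇑(degeneracyMap1 M N d k g) : ℍ → ℂ) =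
      ⇑g ∣[k] glCast (diagGL (d : ℚ) 1 (Nat.cast_pos.mpr (NeZero.pos d)) one_pos : GL (Fin 2) ℚ) := by
  change ⇑(cuspHeckeCorrespondence _ _ k _ g) = _
  rw [coe_cuspHeckeCorrespondence_eq_sum _ _ k _ (isDoubleCosetDecomp_diagGL_gamma1 (NeZero.pos d) hMd)]
  simp

end DegeneracySlash

/-! ### Diamond operators and degeneracy maps; `Γ₀(M)`-invariant forms of level `Γ₁(M)` -/

section Diamond

variable (N : ℕ) [NeZero N] (k : ℤ)

/-- **`⟨d⟩ F = F ∣[k] γ` for *any* `γ ∈ Γ₀(N)` with lower-right entry `≡ d`** (Diamond–Shurman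
§5.2, p. 168: `⟨d⟩ f = f[α]_k` "for any `α = (a b; c δ) ∈ Γ₀(N)` with `δ ≡ d (mod N)`"): the
definition of `diamondOp` uses a chosen lift, and the choice is immaterial
(`slash_mapGL_eq_of_Gamma0Map_eq`). [cite: DiamondShurman2005, §5.2 p. 168] -/
theorem coe_diamondOp_gamma0Map (γ : Gamma0 N) (F : CuspForm (Gamma1 N) k) :
    (⇑(diamondOp N k (Gamma0Map N γ) F) : ℍ → ℂ) = ⇑F ∣[k] (mapGL ℝ (γ : SL(2, ℤ))) := by
  have h : ∃ γ' : Gamma0 N, Gamma0Map N γ' = Gamma0Map N γ := ⟨γ, rfl⟩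
  rw [diamondOp, dif_pos h, coe_cuspHeckeOperatorₗ_gamma1]
  exact slash_mapGL_eq_of_Gamma0Map_eq N k h.choose_spec F

variable {N} in
omit [NeZero N] in
/-- `Gamma0Map` is the lower-right entry mod `N`. [folklore] -/
lemma gamma0Map_eq_intCast (γ : Gamma0 N) :
    Gamma0Map N γ = (((γ : SL(2, ℤ)) 1 1 : ℤ) : ZMod N) := rfl

/-- **Diamond operators commute with the degeneracy maps**: for `M p ∣ N` and a unit `d` mod `N`,
`⟨d⟩_N (ι g) = ι (⟨d mod M⟩_M g)` for `ι = degeneracyMap1 M N p k = [α_p]_k`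
(Diamond–Shurman Prop. 5.6.2 / Exercise 5.6.3(a), first diagram with `T = ⟨d⟩`: `α_p γ α_p⁻¹ ∈ Γ₀(M)`
has the same lower-right entry as `γ ∈ Γ₀(N)`). [cite: DiamondShurman2005, Prop. 5.6.2] -/
theorem diamondOp_degeneracyMap1 {M p : ℕ} [NeZero M] [NeZero p] (hMp : M * p ∣ N) {d : ZMod N}
    (hd : IsUnit d) (g : CuspForm (Gamma1 M) k) :
    diamondOp N k d (degeneracyMap1 M N p k g) =
      degeneracyMap1 M N p k
        (diamondOp M k (ZMod.castHom ((dvd_mul_right M p).trans hMp) (ZMod M) d) g) := by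
  obtain ⟨γ, rfl⟩ := exists_gamma0Map_eq_holds N hd
  obtain ⟨γ', hγ', h11, -, key⟩ :=
    exists_diagGL_mul_mapGL_mul_inv_eq (NeZero.pos p) hMp γ.2
  have hcast : ZMod.castHom ((dvd_mul_right M p).trans hMp) (ZMod M) (Gamma0Map N γ) =
      Gamma0Map M ⟨γ', hγ'⟩ := by
    rw [gamma0Map_eq_intCast, gamma0Map_eq_intCast, map_intCast]
    exact congrArg (fun z : ℤ ↦ (z : ZMod M)) h11.symm
  apply DFunLike.coe_injective
  rw [coe_diamondOp_gamma0Map, coe_degeneracyMap1_eq_slash M N p k hMp, hcast, coe_degeneracyMap1_eq_slash M N p k hMp,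
    coe_diamondOp_gamma0Map, ← SlashAction.slash_mul, ← SlashAction.slash_mul]
  congr 1
  rw [← key]
  group

/-- **A form of level `Γ₁(M)` fixed by all diamond operators comes from `Γ₀(M)`**
(Diamond–Shurman §4.3, p. 119 and §5.2, p. 169: `M_k(Γ₀(N)) = M_k(N, 𝟙)`, the `𝟙`-eigenspace of
the `⟨d⟩`): if `⟨d⟩ G = G` for every unit `d` then `G = liftToGamma1 G₀` for a (unique) cusp form
`G₀` of level `Γ₀(M)` with the same underlying function (every `γ ∈ Γ₀(M)` acts as `⟨δ_γ⟩`; the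
cusps of `Γ₀(M)` are cusps of the finite-index subgroup `Γ₁(M)`). [cite: DiamondShurman2005, §4.3 p. 119 and §5.2 p. 169] -/
theorem exists_liftToGamma1_eq_of_forall_diamondOp_eq {M : ℕ} [NeZero M] (G : CuspForm (Gamma1 M) k)
    (hG : ∀ d : ZMod M, IsUnit d → diamondOp M k d G = G) :
    ∃ G₀ : CuspForm (Gamma0 M) k, liftToGamma1 M k G₀ = G := by
  have hslash : ∀ γ ∈ (Gamma0 M : Subgroup (GL (Fin 2) ℝ)), (⇑G : ℍ → ℂ) ∣[k] γ = ⇑G := by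
    rintro - ⟨γ, hγ, rfl⟩
    have h := congrArg (fun F : CuspForm (Gamma1 M) k ↦ (⇑F : ℍ → ℂ))
      (hG _ (isUnit_Gamma0Map M ⟨γ, hγ⟩))
    simpa only [coe_diamondOp_gamma0Map] using h
  let G₀ : CuspForm (Gamma0 M) k :=
    { toFun := G
      slash_action_eq' := fun γ hγ ↦ hslash γ hγ
      holo' := G.holo'
      zero_at_cusps' := fun hc ↦ G.zero_at_cusps' hc.of_isFiniteRelIndex }
  refine ⟨G₀, DFunLike.coe_injective ?_⟩
  rw [coe_liftToGamma1_holds]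
  rfl

/-- `degeneracyMap1 ∘ liftToGamma1 = liftToGamma1 ∘ degeneracyMap0` (both are `g ↦ g ∣[k] α_d` on
functions, `M d ∣ N`). [folklore] -/
theorem degeneracyMap1_liftToGamma1 {M d : ℕ} [NeZero M] [NeZero d] (hMd : M * d ∣ N)
    (g : CuspForm (Gamma0 M) k) :
    degeneracyMap1 M N d k (liftToGamma1 M k g) = liftToGamma1 N k (degeneracyMap0 M N d k g) := by
  apply DFunLike.coe_injective
  rw [coe_degeneracyMap1_eq_slash M N d k hMd, coe_liftToGamma1_holds, coe_liftToGamma1_holds,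
    coe_degeneracyMap0_eq_slash M N d k hMd]

/-- `liftToGamma1` is injective (it does not change the underlying function). [folklore] -/
theorem liftToGamma1_injective : Function.Injective (liftToGamma1 N k) := by
  intro f g h
  apply DFunLike.coe_injective
  rw [← coe_liftToGamma1_holds N k f, ← coe_liftToGamma1_holds N k g, h]

end Diamond

/-! ### The Main Lemma on `Γ₀(N)` (Atkin–Lehner 1970, Thm. 1) from Diamond–Shurman Thm. 5.7.1 -/

section MainLemma0

variable (N : ℕ) [NeZero N] (k : ℤ)

/-- The underlying function of a finite sum of cusp forms is the sum of the underlying functions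
(Mathlib's `CuspForm.coeHom` is additive). [folklore] -/
lemma coe_cuspForm_finset_sum {Γ : Subgroup (GL (Fin 2) ℝ)} {k : ℤ} {ι : Type*} (s : Finset ι)
    (F : ι → CuspForm Γ k) : (⇑(∑ i ∈ s, F i) : ℍ → ℂ) = ∑ i ∈ s, ⇑(F i) :=
  map_sum (CuspForm.coeHom (Γ := Γ) (k := k)) F s

/-- **Core of the passage from `Γ₁(N)` to `Γ₀(N)`**: under the Main Lemma `atkinLehnerMainLemma1 N k`
(Diamond–Shurman Thm. 5.7.1), a cusp form `f ∈ S_k(Γ₀(N))` whose coefficients `a_n(f)`, `n ≥ 1`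
prime to `N`, vanish is a linear combination `f = ∑_{p ∣ N} c_p · degeneracyMap0 (N/p) N p k G_p`
with `G_p ∈ S_k(Γ₀(N/p))`. Proof: by the Main Lemma `f = ∑_p p^{1-k} ι_p g_p` in `S_k(Γ₁(N))`
with `g_p ∈ S_k(Γ₁(N/p))`, `ι_p = degeneracyMap1 (N/p) N p k = [α_p]_k`; applying
`∑_{d ∈ (ℤ/N)ˣ} ⟨d⟩` (which multiplies `f` by `φ(N)`, `diamondOp_liftToGamma1`) and
`⟨d⟩ ι_p = ι_p ⟨d mod N/p⟩` (`diamondOp_degeneracyMap1`) replaces `g_p` by the `⟨·⟩`-invariant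
form `∑_d ⟨d⟩ g_p`, which comes from `S_k(Γ₀(N/p))` (`exists_liftToGamma1_eq_of_forall_diamondOp_eq`;
Diamond–Shurman §5.2, p. 168 and §4.3, p. 119: `S_k(Γ₀(M)) = S_k(M, 𝟙)`). [cite: DiamondShurman2005, Thm. 5.7.1] -/
theorem exists_eq_sum_smul_degeneracyMap0_of_coeff_eq_zero (hML : atkinLehnerMainLemma1 N k)
    (f : CuspForm (Gamma0 N) k)
    (hf : ∀ n : ℕ, 0 < n → n.Coprime N → (qExpansion 1 ⇑f).coeff n = 0) :
    ∃ (G₀ : (p : N.primeFactors) → CuspForm (Gamma0 (N / (p : ℕ))) k) (c : N.primeFactors → ℂ),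
      f = ∑ p : N.primeFactors, c p • degeneracyMap0 (N / (p : ℕ)) N (p : ℕ) k (G₀ p) := by
  classical
  set F := liftToGamma1 N k f with hF
  have hFcoe : (⇑F : ℍ → ℂ) = ⇑f := coe_liftToGamma1_holds N k f
  obtain ⟨g, hg⟩ := hML F (by rw [hFcoe]; exact hf)
  -- positivity / instances at the prime factors
  have hpos : ∀ p : N.primeFactors, 0 < (p : ℕ) := fun p ↦ Nat.pos_of_mem_primeFactors p.2
  have hpdvd : ∀ p : N.primeFactors, (p : ℕ) ∣ N := fun p ↦ Nat.dvd_of_mem_primeFactors p.2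
  haveI hne : ∀ p : N.primeFactors, NeZero (p : ℕ) := fun p ↦ ⟨(hpos p).ne'⟩
  haveI hneM : ∀ p : N.primeFactors, NeZero (N / (p : ℕ)) := fun p ↦
    ⟨(Nat.div_pos (Nat.le_of_dvd (NeZero.pos N) (hpdvd p)) (hpos p)).ne'⟩
  have hMd : ∀ p : N.primeFactors, N / (p : ℕ) * (p : ℕ) ∣ N := fun p ↦ by
    rw [Nat.div_mul_cancel (hpdvd p)]
  have hMN : ∀ p : N.primeFactors, N / (p : ℕ) ∣ N := fun p ↦ Nat.div_dvd_of_dvd (hpdvd p)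
  -- the bundled decomposition of `F`
  have hFsum : F = ∑ p : N.primeFactors,
      ((p : ℕ) : ℂ) ^ (1 - k) • degeneracyMap1 (N / (p : ℕ)) N (p : ℕ) k (g p) := by
    apply DFunLike.coe_injective
    rw [hg, coe_cuspForm_finset_sum]
    refine Finset.sum_congr rfl fun p _ ↦ ?_
    rw [CuspForm.IsGLPos.coe_smul, coe_degeneracyMap1_eq_slash _ N _ k (hMd p)]
  -- the `⟨·⟩`-averages of the `g p` come from `Γ₀(N/p)`
  have hGp : ∀ p : N.primeFactors, ∃ G₀ : CuspForm (Gamma0 (N / (p : ℕ))) k,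
      liftToGamma1 (N / (p : ℕ)) k G₀ =
        ∑ u : (ZMod N)ˣ, diamondOp (N / (p : ℕ)) k (ZMod.castHom (hMN p) (ZMod (N / (p : ℕ))) u)
          (g p) := by
    intro p
    apply exists_liftToGamma1_eq_of_forall_diamondOp_eq
    intro e he
    obtain ⟨e', he'⟩ := ZMod.unitsMap_surjective (hMN p) he.unit
    have he'2 : (ZMod.castHom (hMN p) (ZMod (N / (p : ℕ))) (e' : ZMod N)) = e := by
      have := congrArg (fun x : (ZMod (N / (p : ℕ)))ˣ ↦ (x : ZMod (N / (p : ℕ)))) he'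
      simpa [ZMod.unitsMap_def] using this
    rw [map_sum]
    refine Fintype.sum_equiv (Equiv.mulLeft e') _ _ fun u ↦ ?_
    have hu : IsUnit (ZMod.castHom (hMN p) (ZMod (N / (p : ℕ))) (u : ZMod N)) :=
      (Units.isUnit u).map _
    rw [← Module.End.mul_apply, ← diamondOp_mul_holds _ k he hu, ← he'2, ← map_mul, Equiv.coe_mulLeft,
      Units.val_mul]
  choose G₀ hG₀ using hGp
  -- apply `∑_u ⟨u⟩` to `F`
  have hsumF : ∑ u : (ZMod N)ˣ, diamondOp N k (u : ZMod N) F = (Fintype.card (ZMod N)ˣ : ℂ) • F := by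
    simp only [hF, diamondOp_liftToGamma1, Finset.sum_const, Finset.card_univ, Nat.cast_smul_eq_nsmul]
  have hlift : liftToGamma1 N k ((Fintype.card (ZMod N)ˣ : ℂ) • f) =
      liftToGamma1 N k (∑ p : N.primeFactors,
        ((p : ℕ) : ℂ) ^ (1 - k) • degeneracyMap0 (N / (p : ℕ)) N (p : ℕ) k (G₀ p)) := by
    rw [map_smul, ← hsumF, hFsum]
    simp only [map_sum, map_smul]
    rw [Finset.sum_comm]
    refine Finset.sum_congr rfl fun p _ ↦ ?_
    rw [← Finset.smul_sum, ← degeneracyMap1_liftToGamma1 N k (hMd p), hG₀ p, map_sum]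
    refine congrArg _ (Finset.sum_congr rfl fun u _ ↦ ?_)
    exact diamondOp_degeneracyMap1 N k (hMd p) (Units.isUnit u) (g p)
  have heq := liftToGamma1_injective N k hlift
  have hcard : (Fintype.card (ZMod N)ˣ : ℂ) ≠ 0 := Nat.cast_ne_zero.mpr Fintype.card_ne_zero
  refine ⟨G₀, fun p ↦ (Fintype.card (ZMod N)ˣ : ℂ)⁻¹ * ((p : ℕ) : ℂ) ^ (1 - k), ?_⟩
  simp_rw [mul_smul, ← Finset.smul_sum, ← heq, smul_smul, inv_mul_cancel₀ hcard, one_smul]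

/-- **Atkin–Lehner 1970, Thm. 1 from Diamond–Shurman Thm. 5.7.1**: the `Γ₁(N)` Main Lemma
`atkinLehnerMainLemma1 N k` implies the `Γ₀(N)` Main Lemma `atkinLehnerMainLemma0 N k` of
`NewformsLevelRaising` (`f ∈ S_k(Γ₀(N))` with `a_n(f) = 0` for `(n, N) = 1` is `∑_p ι_p f_p` with
`f_p ∈ S_k(Γ₀(N/p))`), via `exists_eq_sum_smul_degeneracyMap0_of_coeff_eq_zero` and
`degeneracyMap0 = p^{k-1} ι_p` (`range_iota_eq_range_degeneracyMap0`). [cite: DiamondShurman2005, Thm. 5.7.1] -/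
theorem atkinLehnerMainLemma0_of_mainLemma1 (hML : atkinLehnerMainLemma1 N k) :
    atkinLehnerMainLemma0 N k := by
  intro f hf
  obtain ⟨G₀, c, hfeq⟩ :=
    exists_eq_sum_smul_degeneracyMap0_of_coeff_eq_zero N k hML f (fun n _ hn ↦ hf n hn)
  rw [hfeq]
  refine Submodule.sum_mem _ fun p _ ↦ Submodule.smul_mem _ _ (Submodule.mem_iSup_of_mem p ?_)
  rw [range_iota_eq_range_degeneracyMap0]
  exact LinearMap.mem_range_self _ _

/-- **The Main Lemma on `Γ₀(N)` in terms of `oldSubspace0`** (Atkin–Lehner 1970, Thm. 1;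
Diamond–Shurman Thm. 5.7.1 with Def. 5.6.1): under `atkinLehnerMainLemma1 N k`, a cusp form
`f ∈ S_k(Γ₀(N))` whose Fourier coefficients `a_n(f)` vanish for all `n ≥ 1` prime to `N` lies in
the old subspace `oldSubspace0 N k` (each `degeneracyMap0 (N/p) N p k G_p` does, `(N/p, p)` being a
degeneracy index). [cite: DiamondShurman2005, Thm. 5.7.1] -/
theorem mem_oldSubspace0_of_coeff_eq_zero (hML : atkinLehnerMainLemma1 N k)
    (f : CuspForm (Gamma0 N) k)
    (hf : ∀ n : ℕ, 0 < n → n.Coprime N → (qExpansion 1 ⇑f).coeff n = 0) :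
    f ∈ oldSubspace0 N k := by
  obtain ⟨G₀, c, hfeq⟩ := exists_eq_sum_smul_degeneracyMap0_of_coeff_eq_zero N k hML f hf
  rw [hfeq]
  refine Submodule.sum_mem _ fun p _ ↦ Submodule.smul_mem _ _ ?_
  have hpd : N / (p : ℕ) ∈ N.properDivisors := Nat.mem_properDivisors.mpr
    ⟨Nat.div_dvd_of_dvd (Nat.dvd_of_mem_primeFactors p.2),
      Nat.div_lt_self (NeZero.pos N) (Nat.prime_of_mem_primeFactors p.2).one_lt⟩
  exact Submodule.mem_iSup_of_mem
    (⟨(N / (p : ℕ), (p : ℕ)), hpd, div_mul_dvd_of_mem_primeFactors p⟩ : DegeneracyIndex N)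
    (LinearMap.mem_range_self _ _)

end MainLemma0

/-! ### Consequences: Atkin–Lehner Thms. 3 and 4 on `Γ₀(N)` from Diamond–Shurman Thm. 5.7.1 -/

section AtkinLehner

variable (N : ℕ) [NeZero N] (k : ℤ)

/-- **Atkin–Lehner 1970, Thm. 3 (the `w_N` part) from Diamond–Shurman Thm. 5.7.1**: every newform on
`Γ₀(N)` is a `w_N`-eigenvector with eigenvalue `±1`, assuming the `Γ₁(N)` Main Lemma
`atkinLehnerMainLemma1 N k` (`IsNewform0.exists_frickeInvolution_eq_smul_of_mainLemma0` of `NewformsFrickeSignProofs` with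
`atkinLehnerMainLemma0_of_mainLemma1`; cf. the namesake `…_of_mainLemma` of
`CuspFormLFunctionAtkinLehnerProofs`, conditional on the `Γ₀(N)` Main Lemma and `old ⊓ new = 0`). [cite: AtkinLehner1970, Thm. 3] -/
theorem IsNewform0.exists_frickeInvolution_eq_smul_of_mainLemma1 (hML : atkinLehnerMainLemma1 N k) :
    IsNewform0.exists_frickeInvolution_eq_smul (N := N) (k := k) :=
  IsNewform0.exists_frickeInvolution_eq_smul_of_mainLemma0 N k (atkinLehnerMainLemma0_of_mainLemma1 N k hML)

/-- **The `w_N`-facts and Hecke's functional equation for newforms, from Diamond–Shurman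
Thm. 5.7.1**: under the `Γ₁(N)` Main Lemma `atkinLehnerMainLemma1 N k` all of
`IsNewform0.exists_frickeInvolution_eq_smul`, `IsNewform0.frickeInvolution_eq_smul`,
`IsNewform0.frickeEigenvalue_eq_one_or_eq_neg_one` and `IsNewform0.exists_functional_equation`
hold at level `N`, weight `k` (`IsNewform0.frickeFacts_of_mainLemma0` of `NewformsFrickeSignProofs`
with `atkinLehnerMainLemma0_of_mainLemma1`). [cite: AtkinLehner1970, Thm. 3] -/
theorem IsNewform0.frickeFacts_of_mainLemma1 (hML : atkinLehnerMainLemma1 N k) :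
    IsNewform0.exists_frickeInvolution_eq_smul (N := N) (k := k) ∧
      IsNewform0.frickeInvolution_eq_smul (N := N) (k := k) ∧
      IsNewform0.frickeEigenvalue_eq_one_or_eq_neg_one (N := N) (k := k) ∧
      IsNewform0.exists_functional_equation (N := N) (k := k) :=
  IsNewform0.frickeFacts_of_mainLemma0 N k (atkinLehnerMainLemma0_of_mainLemma1 N k hML)

/-- **Strong multiplicity one on `Γ₀(N)` from the Main Lemma** (Atkin–Lehner 1970, Thm. 4, same
level): two newforms in `S_k(Γ₀(N))` whose `T_p`-eigenvalues agree for all but finitely many primes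
are equal (`IsNewform0.eq_of_heckeEigenvalue_eq` of `Newforms`), assuming only
`atkinLehnerMainLemma1 N k` (Diamond–Shurman Thm. 5.7.1): `NewformsLevelRaising` proves it from the
`Γ₀(N)` Main Lemma `atkinLehnerMainLemma0 N k` and `disjoint_oldSubspace0_newSubspace0 N k`
(`IsNewform0.eq_of_heckeEigenvalue_eq_of_facts`), which are `atkinLehnerMainLemma0_of_mainLemma1`
and `disjoint_oldSubspace0_newSubspace0_holds` (`NewformsOldNewProofs`). [cite: AtkinLehner1970, Thm. 4] -/
theorem IsNewform0.eq_of_heckeEigenvalue_eq_of_mainLemma1 (hML : atkinLehnerMainLemma1 N k) :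
    IsNewform0.eq_of_heckeEigenvalue_eq (N := N) (k := k) :=
  IsNewform0.eq_of_heckeEigenvalue_eq_of_facts (atkinLehnerMainLemma0_of_mainLemma1 N k hML)
    (disjoint_oldSubspace0_newSubspace0_holds N k)

end AtkinLehner

end Literature.NumberTheory.EllipticCurves.ModularForms

end
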